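/-
Copyright (c) 2026 the pub-hodgecm-mathlib formalisation cell (harness21).  Prover seat hodgecm-mathlib-K2E4-p23 (g2), Track B ∕ K2-LIT, h413 =
`stmt-HodgeConjecture-24833`, ENGINE E1, 5Res campaign, deal (113) of the dealer K2E1-plan (g6) 2026-09-04T11:00:58Z, part (ii-a): the LOCAL IWASAWA ALGEBRA at one
complex place behind «the κ-isotypic matrix coefficient of the flat section along the single-place torus = ★ `archTorusCoeff`» (first half of the `hmc` payer).
-/
import Summits.HodgeConjecture.HodgeConjecture.Theorems.K2E1ArchTorusFamilyU11Defs        -- ★ (this seat) (113)(i): `torusLoc`, `circleLoc`, `torusAt`, `circleAt`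
import Summits.HodgeConjecture.HodgeConjecture.Theorems.K2E1ArchTorusCoefficientU11Defs   -- ★ (this seat) F2a: `torusW`, `archTorusIntegrand`, `archTorusCoeff`, periodicity
import Summits.HodgeConjecture.HodgeConjecture.Theorems.K2E1CharacterEisensteinU2Defs     -- ★ p859441: `IsChiSection`, `flatSectionU_borel_mul_of_isChiSection`
import Summits.HodgeConjecture.HodgeConjecture.Theorems.K2E1ArchComponentKTypeU2          -- ★ p858662: `archComponent_apply_eq`, `norm_archComponent_add_sub` (k_w = (a b; b a), |a ± b| = 1)
import Literature.NumberTheory.Automorphic.UnitaryGroupIwasawaAdelic                      -- ★ `exists_mem_borelAdelic_mul_mem_standardMaximalCompactGL_cm`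
import Mathlib.MeasureTheory.Integral.IntervalIntegral.Periodic
import HarnessLib

/-!
# K2·E1 — `K2E1ArchLocalIwasawaU11`: THE LOCAL IWASAWA DECOMPOSITION `k_w(1,ζ)·t_w(a) = b·k_w(u″,v″)` OF `U(1,1)(ℝ)` AT ONE COMPLEX PLACE, AND `(k_∞)_w ∈ K_w` AS A `circleLoc`
# (deal (113)(ii-a): the algebra behind «`(2π)⁻¹∫₀^{2π} e^{−iqθ} f_z(g·k_w(θ)·t_w(a)) dθ = archTorusCoeff (z + it) (p − q) a · f_z(g)`», whose global assembly is FILE (ii-b))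

Track B ∕ K2-LIT, crux h413 = `stmt-HodgeConjecture-24833`, route of record `HCCMUnconditional`; cell `hodgecm-mathlib`, squad K2, ENGINE E1 (5Res campaign, ARCH-UNITARITY leg,
this seat's census (45c) and design 2026-09-04T11:04Z: NO `K_∞`-Haar projector — the average over the one-parameter circle `θ ↦ circleAt w 1 (e^{iθ})`).  Prover seat
`hodgecm-mathlib-K2E4-p23` (g2); deal (113) of the dealer K2E1-plan (g6).  THEOREMS ONLY (no `def`, no `instance`, no notation, no named-fact hypothesis, no `sorry`); lane
`--supports stmt-HodgeConjecture-24833 --as helper` (count-neutral).  CLOSES NO SOCKET.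

THE TARGET IDENTITY (FILE (ii-b) `K2E1ArchTorusActionFlatSectionU11`, assembled from THIS file).  `f = f_z = flatSectionU φ z` for a `χ`-section `φ` (★ `IsChiSection`), read at ONE complex place `w` through two LETTERS (dischargeable from `φ`'s `K_w`-type and `χ`'s
archimedean component; payer = the (χ,τ)-campaign): (K) the right `K_w`-type `(p, q)`: `f(x · circleAt w u v) = u^p v^q f(x)` (`u, v ∈ 𝕊¹`); (B) the left character of the local Borel at
`w` with positive real torus part: `f(adelicSingle w b · x) = (r²)^{z+it} f(x)` for `b ∈ U(1,1)` upper triangular with `b₀₀ = r > 0` (`χ_w|_{ℝ₊} = r^{2it}`, height `r²`).  THEN for every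
`g`, `a > 0`:  **`∫₀^{2π} e^{−iqθ} · f(g · circleAt w 1 (e^{iθ}) · torusAt w a) dθ = (∫₀^{2π} archTorusIntegrand (z + it) (p − q) a θ dθ) · f(g)`**, i.e. the `(2π)⁻¹`-normalised circle
average is `archTorusCoeff (z + it) (p − q) a · f(g)` (★ F2a).  With ★ F2b∕F3 (`arch_unitarity_of_rightRegular_matrixCoeff`) this is the section-level half of `hmc`; the residue half waits
for the (χ,τ)-continuation (SHEET rows 12–13).
PROOF.  Global Iwasawa `g = b₀ k₀` (★ `exists_mem_borelAdelic_mul_mem_standardMaximalCompactGL_cm`); split `k₀ = adelicSingle w κ₀ · k′` with `k′ ∈ awayFrom w` commuting with every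
`adelicSingle w u` (★ `UnitaryGroupArchSection`); `κ₀ ∈ U(1,1) ∩ U(2)` is `circleLoc u₀ v₀` (★ `K2E1ArchComponentKTypeU2`, §2); the LOCAL IWASAWA DECOMPOSITION (§1, pure 2×2 algebra over `ℂ`):
`circleLoc 1 ζ · torusLoc (log a) = b(ζ) · circleLoc u″ v″` with `u″ = W∕|W|`, `v″ = ζ W̄∕|W|`, `b(ζ)` upper triangular with `b₀₀ = 2∕|W_a(ζ)|` REAL (`W_a(ζ) = (a + a⁻¹) − ζ(a − a⁻¹)` = ★
`torusW`); the central `u₀` commutes through, the phase `v₀∕u₀ = e^{iθ₁}` SHIFTS `θ`, and the `2π`-periodic integral is shift-invariant (★ `periodic_archTorusIntegrand`).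
WHAT IS HERE: §1 `iwasawa_num₁₀`, `iwasawa_num₀₀` (the two polynomial identities, `linear_combination` over `ζζ̄ = 1`, `A² − B² = 4`); §2 **`exists_archAt_archPart_eq_circleLoc`**
(`(k_∞)_w = circleLoc u₀ v₀` for `k ∈ K_U`); §3 **`iwasawa_matrix_entries`** (`C(1,ζ)·diag(a,a⁻¹)·C(W̄∕n, ζ̄W∕n)` is upper triangular with `(0,0)`-entry `2∕n`).  NOT here: the
global assembly and the `θ`-integral (FILE (ii-b)).
HONEST LABEL: HC_CM is proved only modulo the 7 printed citations (2 remaining named inputs: hLiu418 = `stmt-HodgeConjecture-24832`, h413 = `stmt-HodgeConjecture-24833`) until rung 0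
closes; this file asserts no named fact and closes no socket; count-neutral.

## References
* [Knapp1986] A. W. Knapp, *Representation Theory of Semisimple Groups* (1986), VII §1 (Iwasawa coordinates, matrix coefficients of the principal series of `SU(1,1)`).
* [BorelJacquet1979] A. Borel, H. Jacquet, PSPM 33.1 (1979), §4.1 (factor inclusions `G(F_v) ↪ G(𝔸)`).
* [MoeglinWaldspurger1995] C. Mœglin, J.-L. Waldspurger (1995), I.2.17, IV.3 (induced spaces; arch unitarity of residual data).
-/

set_option autoImplicit false
-- the mandated namespace repeats the single-problem summit's segment (`HodgeConjecture.HodgeConjecture`)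
set_option linter.dupNamespace false

noncomputable section

open NumberField NumberField.InfinitePlace Matrix MeasureTheory Real Complex intervalIntegral
open scoped MatrixGroups ComplexConjugate
open Literature.NumberTheory.Automorphic Literature.NumberTheory.Automorphic.UnitaryGroup AdelicGroupData
open Literature.NumberTheory.GaloisRepresentations (HeckeCharacter)
open Summit.HodgeConjecture.HodgeConjecture.Cruxes.H413.K2E1BorelEisensteinU
open Summit.HodgeConjecture.HodgeConjecture.Cruxes.H413.K2E1ArchTorusFamilyU11Defs
open Summit.HodgeConjecture.HodgeConjecture.Cruxes.H413.K2E1ArchTorusCoefficientU11Defs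
open Summit.HodgeConjecture.HodgeConjecture.Cruxes.H413.K2E1CharacterEisensteinU2Defs
open Summit.HodgeConjecture.HodgeConjecture.Cruxes.H413.K2E1ArchComponentKTypeU2

namespace Summit.HodgeConjecture.HodgeConjecture.Cruxes.H413.K2E1ArchLocalIwasawaU11

/-! ## §1 The algebra of the local Iwasawa decomposition (pure `ℂ`) -/

/-- The (1,0) numerator vanishes: `(1−ζ)(A+B)(W̄ + ζ̄W) + (1+ζ)(A−B)(W̄ − ζ̄W) = 0` for `ζζ̄ = 1`, `W = A − ζB`, `W̄ = A − ζ̄B` (it equals `2AW(1 − ζζ̄)`). [folklore] -/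
theorem iwasawa_num₁₀ (A B : ℝ) {ζ ζb W Wb : ℂ} (h1 : ζ * ζb = 1) (hW : W = A - ζ * B) (hWb : Wb = A - ζb * B) :
    (1 - ζ) * ((A : ℂ) + B) * (Wb + ζb * W) + (1 + ζ) * ((A : ℂ) - B) * (Wb - ζb * W) = 0 := by
  rw [hW, hWb]
  linear_combination (-(2 : ℂ) * A * (A - ζ * B)) * h1

/-- The (0,0) numerator is `16`: `(1+ζ)(A+B)(W̄ + ζ̄W) + (1−ζ)(A−B)(W̄ − ζ̄W) = 16` for `ζζ̄ = 1`, `A² − B² = 4`. [folklore] -/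
theorem iwasawa_num₀₀ (A B : ℝ) (hAB : A ^ 2 - B ^ 2 = 4) {ζ ζb W Wb : ℂ} (h1 : ζ * ζb = 1) (hW : W = A - ζ * B) (hWb : Wb = A - ζb * B) :
    (1 + ζ) * ((A : ℂ) + B) * (Wb + ζb * W) + (1 - ζ) * ((A : ℂ) - B) * (Wb - ζb * W) = 16 := by
  have hAB' : (A : ℂ) ^ 2 - (B : ℂ) ^ 2 = 4 := by exact_mod_cast hAB
  rw [hW, hWb]
  linear_combination (-(4 : ℂ) * B ^ 2 + 2 * (A - ζ * B) * (A + ζb * B) - 2 * ζb * (A - ζ * B) * B) * h1 + 4 * hAB'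

variable (L : Type) [Field L] [NumberField L] [IsCMField L] (w : {w : InfinitePlace L // IsComplex w})

/-! ## §2 The `w`-component of `k ∈ K_U` is a `circleLoc` -/

/-- **For `k ∈ K_U`, `(k_∞)_w = circleLoc u₀ v₀`** with `u₀ = k₀₀ + k₀₁`, `v₀ = k₀₀ − k₀₁ ∈ 𝕊¹` (★ `archComponent_apply_eq`, ★ `norm_archComponent_add_sub`). [cite: Garrett2018, §2.2] -/
theorem exists_archAt_archPart_eq_circleLoc {k : (quasiSplit (↥(maximalRealSubfield L)) L (IsCMField.complexConj L) 2).Adelic}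
    (hk : k ∈ ((standardMaximalCompactGL 2 L).comap (adelicVal ↥(maximalRealSubfield L) L (IsCMField.complexConj L) 2 ((StdForm.antidiagonal 2).over L)) :
      Subgroup (quasiSplit (↥(maximalRealSubfield L)) L (IsCMField.complexConj L) 2).Adelic)) :
    ∃ u₀ v₀ : Circle, archAt (↥(maximalRealSubfield L)) L (IsCMField.complexConj L) 2 ((StdForm.antidiagonal 2).over L) w (complexConj_smul_infinitePlace L w.1)
        (IsCMField.complexConj_ne_one L) (archPart (↥(maximalRealSubfield L)) L (IsCMField.complexConj L) 2 ((StdForm.antidiagonal 2).over L) k) = circleLoc L w u₀ v₀ := by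
  set M : Matrix (Fin 2) (Fin 2) ℂ := ((Matrix.GeneralLinearGroup.map (evalC L w) (GLn.toMixed 2 L (adelicVal ↥(maximalRealSubfield L) L (IsCMField.complexConj L) 2
    ((StdForm.antidiagonal 2).over L) k)) : GL (Fin 2) ℂ) : Matrix (Fin 2) (Fin 2) ℂ) with hM
  obtain ⟨h00, h01⟩ := archComponent_apply_eq L hk w
  obtain ⟨hadd, hsub⟩ := norm_archComponent_add_sub L hk w
  refine ⟨⟨M 0 0 + M 0 1, by simpa [Submonoid.unitSphere, M] using hadd⟩, ⟨M 0 0 - M 0 1, by simpa [Submonoid.unitSphere, M] using hsub⟩, ?_⟩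
  apply Subtype.ext
  apply Matrix.GeneralLinearGroup.ext
  intro i j
  rw [coe_circleLoc, circleLocMatrix]
  change M i j = _
  fin_cases i <;> fin_cases j
  · show M 0 0 = ((M 0 0 + M 0 1) + (M 0 0 - M 0 1)) / 2
    ring
  · show M 0 1 = ((M 0 0 + M 0 1) - (M 0 0 - M 0 1)) / 2
    ring
  · show M 1 0 = ((M 0 0 + M 0 1) - (M 0 0 - M 0 1)) / 2
    have h01' : M 0 1 = M 1 0 := h01
    rw [← h01']
    ring
  · show M 1 1 = ((M 0 0 + M 0 1) + (M 0 0 - M 0 1)) / 2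
    have h00' : M 0 0 = M 1 1 := h00
    rw [← h00']
    ring

/-! ## §3 The local Iwasawa decomposition: entries of `C(1,ζ)·diag(a,a⁻¹)·C(W̄∕|W|, ζ̄W∕|W|)` -/

/-- **LOCAL IWASAWA, MATRIX FORM.**  For `a > 0` real, `ζζ̄ = 1`, `W = (a+a⁻¹) − ζ(a−a⁻¹)`, `W̄ = (a+a⁻¹) − ζ̄(a−a⁻¹)`, `n² = WW̄`, `n ≠ 0`: the product
`C(1,ζ)·diag(a,a⁻¹)·C(W̄∕n, ζ̄W∕n)` (with `C(u,v) = ((u+v)∕2 (u−v)∕2; (u−v)∕2 (u+v)∕2)`) has `(1,0)`-entry `0` and `(0,0)`-entry `2∕n` — i.e.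
`C(1,ζ)·diag(a,a⁻¹) = b·C(W∕n, ζW̄∕n)` with `b` upper triangular, `b₀₀ = 2∕n`. [cite: Knapp1986, VII §1] -/
theorem iwasawa_matrix_entries {a : ℝ} (ha : 0 < a) {ζ ζb W Wb n : ℂ} (h1 : ζ * ζb = 1) (hW : W = ((a + a⁻¹ : ℝ) : ℂ) - ζ * ((a - a⁻¹ : ℝ) : ℂ))
    (hWb : Wb = ((a + a⁻¹ : ℝ) : ℂ) - ζb * ((a - a⁻¹ : ℝ) : ℂ)) (hn0 : n ≠ 0) :
    (!![(1 + ζ) / 2, (1 - ζ) / 2; (1 - ζ) / 2, (1 + ζ) / 2] * !![(a : ℂ), 0; 0, (a : ℂ)⁻¹] *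
        !![(Wb / n + ζb * W / n) / 2, (Wb / n - ζb * W / n) / 2; (Wb / n - ζb * W / n) / 2, (Wb / n + ζb * W / n) / 2]) 1 0 = 0 ∧
    (!![(1 + ζ) / 2, (1 - ζ) / 2; (1 - ζ) / 2, (1 + ζ) / 2] * !![(a : ℂ), 0; 0, (a : ℂ)⁻¹] *
        !![(Wb / n + ζb * W / n) / 2, (Wb / n - ζb * W / n) / 2; (Wb / n - ζb * W / n) / 2, (Wb / n + ζb * W / n) / 2]) 0 0 = 2 / n := by
  have ha0 : (a : ℂ) ≠ 0 := Complex.ofReal_ne_zero.2 ha.ne'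
  -- the `A, B` coordinates: `a = (A+B)/2`, `a⁻¹ = (A−B)/2`, `A² − B² = 4`
  have hAB : (a + a⁻¹) ^ 2 - (a - a⁻¹) ^ 2 = 4 := by field_simp; ring
  have h10 := iwasawa_num₁₀ (a + a⁻¹) (a - a⁻¹) h1 hW hWb
  have h00 := iwasawa_num₀₀ (a + a⁻¹) (a - a⁻¹) hAB h1 hW hWb
  push_cast at h10 h00
  constructor
  · simp only [Matrix.mul_apply, Fin.sum_univ_two, Matrix.of_apply, Matrix.cons_val', Matrix.cons_val_zero, Matrix.cons_val_one,
      Matrix.empty_val', Matrix.cons_val_fin_one]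
    have e : (1 - ζ) / 2 * (a : ℂ) * ((Wb / n + ζb * W / n) / 2) + (1 + ζ) / 2 * (a : ℂ)⁻¹ * ((Wb / n - ζb * W / n) / 2) =
        ((1 - ζ) * (((a + a⁻¹ : ℝ) : ℂ) + ((a - a⁻¹ : ℝ) : ℂ)) * (Wb + ζb * W) + (1 + ζ) * (((a + a⁻¹ : ℝ) : ℂ) - ((a - a⁻¹ : ℝ) : ℂ)) * (Wb - ζb * W)) / (8 * n) := by
      push_cast
      field_simp
      ring
    rw [show (1 - ζ) / 2 * (a : ℂ) + (1 + ζ) / 2 * 0 = (1 - ζ) / 2 * (a : ℂ) by ring,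
      show (1 - ζ) / 2 * 0 + (1 + ζ) / 2 * (a : ℂ)⁻¹ = (1 + ζ) / 2 * (a : ℂ)⁻¹ by ring, e]
    push_cast
    rw [h10, zero_div]
  · simp only [Matrix.mul_apply, Fin.sum_univ_two, Matrix.of_apply, Matrix.cons_val', Matrix.cons_val_zero, Matrix.cons_val_one,
      Matrix.empty_val', Matrix.cons_val_fin_one]
    have e : (1 + ζ) / 2 * (a : ℂ) * ((Wb / n + ζb * W / n) / 2) + (1 - ζ) / 2 * (a : ℂ)⁻¹ * ((Wb / n - ζb * W / n) / 2) =
        ((1 + ζ) * (((a + a⁻¹ : ℝ) : ℂ) + ((a - a⁻¹ : ℝ) : ℂ)) * (Wb + ζb * W) + (1 - ζ) * (((a + a⁻¹ : ℝ) : ℂ) - ((a - a⁻¹ : ℝ) : ℂ)) * (Wb - ζb * W)) / (8 * n) := by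
      push_cast
      field_simp
      ring
    rw [show (1 + ζ) / 2 * (a : ℂ) + (1 - ζ) / 2 * 0 = (1 + ζ) / 2 * (a : ℂ) by ring,
      show (1 + ζ) / 2 * 0 + (1 - ζ) / 2 * (a : ℂ)⁻¹ = (1 - ζ) / 2 * (a : ℂ)⁻¹ by ring, e]
    push_cast
    rw [h00]
    field_simp
    ring

end Summit.HodgeConjecture.HodgeConjecture.Cruxes.H413.K2E1ArchLocalIwasawaU11

end
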